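import Summits.RiemannHypothesis.RiemannHypothesis.Theorems.GroundBartaEvenWinsBeyondArchDeflationWeightedRitz
import Summits.RiemannHypothesis.RiemannHypothesis.Theorems.GroundBartaEvenWinsBeyondArchDeflationSigma
import Literature.NumberTheory.LFunctions.WeilMarkovThreePrime
import HarnessLib

/-!
# RiemannHypothesis / GroundBarta — rung 4 (`EvenWinsBeyondArch`, stmt-RiemannHypothesis-18807 / 18085):
# the deflated Temple L-side on the three-prime band — window invariance and the SHELL TRANSFER of the PSD datum

Helper file (`--supports stmt-RiemannHypothesis-18085`), RH-free, no definitions, no named facts.  Prover B (gen 6 of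
unit `sr-gb-rung-b`).

Two elementary facts behind the ENDPOINT CELL `a* = (log 5)/2` of the window ladder, where the test window `c = a*`
is irrational and every certified datum lives at rational cuts `c' ≤ c ≤ b` with `log 2 < c'` and `c ≤ (log 5)/2`:

* **band invariance** — on the three-prime band `log 2 < a ≤ (log 5)/2` the prime index set `weilPrimeIndex a`
  is one and the same Finset (`dt_weilPrimeIndex_eq_of_band`), hence the killing constant `M_a`, the polar Dirichlet
  energy `𝓔₂ a` and the prime layer of every window image do not depend on the window inside the band
  (`dt_weilMarkovConstant_eq_of_band`, `dt_weilDirichletEnergy₂_eq_of_band`);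
* **shell transfer** — the weighted residual Gram form `Σ α_iα_j ∫ w Re(r_i r̄_j)` of residuals `r_i` that agree with
  reference residuals `rx_i` wherever any of them is non-zero is dominated by that of the `rx_i`
  (`dt_wgram_le_of_dominated`), so a PSD datum `N − R_w(rx) ⪰ 0` implies `N − R_w(r) ⪰ 0` (`dt_hPSD_of_dominated`).
  Use: `r_i = F_i^{(c)} − Σ W v` for the window-`c` images of vectors cut at `c'`, `rx_i` the same with the window
  indicator widened to the rational `b ≥ c`; they agree on `[-c, c]` and `r_i = 0` off it.
-/

set_option linter.dupNamespace false

noncomputable section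

open MeasureTheory Set Filter
open scoped Topology ENNReal NNReal ComplexConjugate BigOperators

namespace Summit.RiemannHypothesis.RiemannHypothesis.Theorems.EvenWinsBeyondArch

open Literature.NumberTheory.LFunctions
open Summit.RiemannHypothesis.RiemannHypothesis.Theorems.OddSector (weilIncrement₂ weilDirichletEnergy₂ weilPoleForm₂)

/-! ## Band invariance of the window data -/

/-- **On the three-prime band the prime index set is constant**: for `log 2 < c' ≤ c ≤ (log 5)/2`,
`weilPrimeIndex c = weilPrimeIndex c'` (both are `{n : log n < log 5} = {0, …, 4}`). [folklore] -/
theorem dt_weilPrimeIndex_eq_of_band {c c' : ℝ} (hc' : Real.log 2 < c') (hcc : c' ≤ c)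
    (hc5 : c ≤ Real.log 5 / 2) : weilPrimeIndex c = weilPrimeIndex c' := by
  ext n
  rw [mem_weilPrimeIndex, mem_weilPrimeIndex]
  constructor
  · intro h
    -- `log n < 2c ≤ log 5` forces `n ≤ 4`, hence `log n ≤ log 4 = 2 log 2 < 2c'`
    have h5 : Real.log n < Real.log 5 := by linarith
    have hn5 : n < 5 := by
      by_contra hge
      have hge' : 5 ≤ n := not_lt.1 hge
      have : Real.log 5 ≤ Real.log n := Real.log_le_log (by norm_num) (by exact_mod_cast hge')
      linarith
    have hlog4 : Real.log (n : ℝ) ≤ Real.log 4 := by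
      rcases Nat.eq_zero_or_pos n with rfl | hn
      · simp only [Nat.cast_zero, Real.log_zero]; exact Real.log_nonneg (by norm_num)
      · exact Real.log_le_log (by exact_mod_cast hn) (by exact_mod_cast (by omega : n ≤ 4))
    have h4 : Real.log 4 = 2 * Real.log 2 := by
      rw [show (4 : ℝ) = 2 ^ 2 by norm_num, Real.log_pow]; norm_num
    linarith
  · intro h; linarith

/-- **The killing constant is constant on the three-prime band.** [folklore] -/
theorem dt_weilMarkovConstant_eq_of_band {c c' : ℝ} (hc' : Real.log 2 < c') (hcc : c' ≤ c)
    (hc5 : c ≤ Real.log 5 / 2) : weilMarkovConstant c = weilMarkovConstant c' := by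
  unfold weilMarkovConstant
  rw [dt_weilPrimeIndex_eq_of_band hc' hcc hc5]

/-- **The polar Dirichlet energy is constant on the three-prime band.** [folklore] -/
theorem dt_weilDirichletEnergy₂_eq_of_band {c c' : ℝ} (hc' : Real.log 2 < c') (hcc : c' ≤ c)
    (hc5 : c ≤ Real.log 5 / 2) (f h : ℝ → ℂ) : weilDirichletEnergy₂ c f h = weilDirichletEnergy₂ c' f h := by
  unfold weilDirichletEnergy₂
  rw [dt_weilPrimeIndex_eq_of_band hc' hcc hc5]

/-! ## Shell transfer of the weighted residual Gram form -/

/-- `w · Re(f ḡ)` is integrable for bounded measurable `w` and `f, g ∈ L²`. [folklore] -/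
theorem dt_integrable_wpairing {w : ℝ → ℝ} (hwm : Measurable w) {C : ℝ} (hwC : ∀ y, |w y| ≤ C) {f g : ℝ → ℂ}
    (hf : MemLp f 2) (hg : MemLp g 2) : Integrable fun y ↦ w y * (f y * conj (g y)).re :=
  (dt_integrable_mul_conj_re hf hg).bdd_mul hwm.aestronglyMeasurable
    (Eventually.of_forall fun y ↦ by rw [Real.norm_eq_abs]; exact hwC y)

/-- The weighted Gram quadratic form is the weighted integral of `‖Σ α_i f_i‖²`. [folklore] -/
theorem dt_wgram_quadForm_eq {k : ℕ} {w : ℝ → ℝ} (hwm : Measurable w) {C : ℝ} (hwC : ∀ y, |w y| ≤ C)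
    (f : Fin k → ℝ → ℂ) (hf : ∀ i, MemLp (f i) 2) (α : Fin k → ℝ) :
    ∑ i, ∑ j, α i * α j * ∫ y, w y * (f i y * conj (f j y)).re =
      ∫ y, w y * ‖∑ i, (α i : ℂ) * f i y‖ ^ 2 := by
  have hint : ∀ i j, Integrable fun y ↦ w y * (f i y * conj (f j y)).re := fun i j ↦
    dt_integrable_wpairing hwm hwC (hf i) (hf j)
  -- pull the double sum inside the integral
  have hlhs : ∑ i, ∑ j, α i * α j * ∫ y, w y * (f i y * conj (f j y)).re =
      ∫ y, ∑ i, ∑ j, α i * α j * (w y * (f i y * conj (f j y)).re) := by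
    rw [integral_finsetSum _ fun i _ ↦ integrable_finsetSum _ fun j _ ↦ (hint i j).const_mul _]
    refine Finset.sum_congr rfl fun i _ ↦ ?_
    rw [integral_finsetSum _ fun j _ ↦ (hint i j).const_mul _]
    refine Finset.sum_congr rfl fun j _ ↦ ?_
    rw [integral_const_mul]
  rw [hlhs]
  refine integral_congr_ae (Eventually.of_forall fun y ↦ ?_)
  dsimp only
  rw [← dt_sum_sum_mul_re_eq_norm_sq, Finset.mul_sum]
  refine Finset.sum_congr rfl fun i _ ↦ ?_
  rw [Finset.mul_sum]
  refine Finset.sum_congr rfl fun j _ ↦ ?_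
  ring

/-- **Shell transfer of the weighted residual Gram form.**  If `w ≥ 0` is bounded measurable, `r_i, rx_i ∈ L²`, and at
every point either `r_i = rx_i` for all `i` or `r_i = 0` for all `i`, then
`Σ α_iα_j ∫ w Re(r_i r̄_j) ≤ Σ α_iα_j ∫ w Re(rx_i rx̄_j)`. [folklore] -/
theorem dt_wgram_le_of_dominated {k : ℕ} {w : ℝ → ℝ} (hwm : Measurable w) {C : ℝ} (hwC : ∀ y, |w y| ≤ C)
    (hw0 : ∀ y, 0 ≤ w y) (r rx : Fin k → ℝ → ℂ) (hr : ∀ i, MemLp (r i) 2) (hrx : ∀ i, MemLp (rx i) 2)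
    (hdom : ∀ y, (∀ i, r i y = rx i y) ∨ (∀ i, r i y = 0)) (α : Fin k → ℝ) :
    ∑ i, ∑ j, α i * α j * ∫ y, w y * (r i y * conj (r j y)).re ≤
      ∑ i, ∑ j, α i * α j * ∫ y, w y * (rx i y * conj (rx j y)).re := by
  rw [dt_wgram_quadForm_eq hwm hwC r hr α, dt_wgram_quadForm_eq hwm hwC rx hrx α]
  have hsum : ∀ f : Fin k → ℝ → ℂ, (∀ i, MemLp (f i) 2) → MemLp (fun y ↦ ∑ i, (α i : ℂ) * f i y) 2 := by
    intro f hf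
    have : (fun y ↦ ∑ i, (α i : ℂ) * f i y) = ∑ i, fun y ↦ (α i : ℂ) * f i y := by
      funext y; simp only [Finset.sum_apply]
    rw [this]
    exact memLp_finsetSum' _ fun i _ ↦ (hf i).const_mul _
  have hint : ∀ f : Fin k → ℝ → ℂ, (∀ i, MemLp (f i) 2) →
      Integrable fun y ↦ w y * ‖∑ i, (α i : ℂ) * f i y‖ ^ 2 := by
    intro f hf
    have h2 : Integrable fun y ↦ ‖∑ i, (α i : ℂ) * f i y‖ ^ 2 :=
      (memLp_two_iff_integrable_sq_norm (hsum f hf).1).1 (hsum f hf)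
    exact h2.bdd_mul hwm.aestronglyMeasurable
      (Eventually.of_forall fun y ↦ by rw [Real.norm_eq_abs]; exact hwC y)
  refine integral_mono (hint r hr) (hint rx hrx) fun y ↦ ?_
  rcases hdom y with h | h
  · simp only [h]; exact le_rfl
  · simp only [h, mul_zero, Finset.sum_const_zero, norm_zero]
    rw [zero_pow two_ne_zero, mul_zero]
    exact mul_nonneg (hw0 y) (sq_nonneg _)

/-- **PSD transfer**: under the hypotheses of `dt_wgram_le_of_dominated`, `N − R_w(rx) ⪰ 0` implies
`N − R_w(r) ⪰ 0`. [folklore] -/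
theorem dt_hPSD_of_dominated {k : ℕ} (N : Fin k → Fin k → ℝ) {w : ℝ → ℝ} (hwm : Measurable w) {C : ℝ}
    (hwC : ∀ y, |w y| ≤ C) (hw0 : ∀ y, 0 ≤ w y) (r rx : Fin k → ℝ → ℂ) (hr : ∀ i, MemLp (r i) 2)
    (hrx : ∀ i, MemLp (rx i) 2) (hdom : ∀ y, (∀ i, r i y = rx i y) ∨ (∀ i, r i y = 0))
    (hPSDx : ∀ α : Fin k → ℝ, 0 ≤ ∑ i, ∑ j, α i * α j *
      (N i j - ∫ y, w y * (rx i y * conj (rx j y)).re)) (α : Fin k → ℝ) :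
    0 ≤ ∑ i, ∑ j, α i * α j * (N i j - ∫ y, w y * (r i y * conj (r j y)).re) := by
  have hsplit : ∀ f : Fin k → ℝ → ℂ, ∑ i, ∑ j, α i * α j * (N i j - ∫ y, w y * (f i y * conj (f j y)).re) =
      (∑ i, ∑ j, α i * α j * N i j) - ∑ i, ∑ j, α i * α j * ∫ y, w y * (f i y * conj (f j y)).re := by
    intro f
    rw [← Finset.sum_sub_distrib]
    refine Finset.sum_congr rfl fun i _ ↦ ?_
    rw [← Finset.sum_sub_distrib]
    refine Finset.sum_congr rfl fun j _ ↦ ?_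
    ring
  have h := hPSDx α
  rw [hsplit] at h ⊢
  linarith [dt_wgram_le_of_dominated hwm hwC hw0 r rx hr hrx hdom α]

end Summit.RiemannHypothesis.RiemannHypothesis.Theorems.EvenWinsBeyondArch

end
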